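import Summits.BirchSwinnertonDyer.Rank1Residual.GaloisImage.CubicRootStabilizer
import Summits.BirchSwinnertonDyer.Rank1Residual.GaloisImage.PadicThreeSquareClass
import Mathlib.NumberTheory.Padics.HeightOneSpectrum
import HarnessLib

/-!
# The unramified-cubic subgroup of `Γ_{ℚ₃}` for the record shape: the three `ℚ₃`-facts
# (cell `b2b-bsdres`, team n1011, seat p10 GEN 8; row T-VIS3-UC, FILE 5; note
# `HOME/b2b-bsdres-n1011-p10/g8/L41-NOTE.md` §3, skeleton `cells/n1011/skel/T-VIS3-UC.md`)

HONEST FRAMING (cell `b2b-bsdres`, run/shared/lean/b2b/bsd-rank1-residual/, verbatim in every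
file): the goal of the cell is to DELETE the COMBINATION-SHAPED residual classes of the
Birch–Swinnerton-Dyer formula for ALL analytic-rank `≤ 1` elliptic curves over `ℚ` — "full BSD
formula for every rank `≤ 1` curve in class `C`" assembled STRICTLY from published theorems — so
that the rank-`≤ 1` remainder becomes exactly the CONSTRUCTION-SHAPED classes, which are TYPED
(missing-input `Prop`s), NOT attempted. This is not "finishing BSD". Team n1011 (N10 / N11):
research route on the CONSTRUCTION-SHAPED class X4 (§I N11 LOWER half); no claim beyond the stated
classes; nothing is booked; marks UNCHANGED. Theorems only: no definition, no named fact, no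
`sorry`. TOOL theorems; they close nothing by themselves.

## What

FILE 4 (`CubicRootStabilizer.lean`) turns three decidable facts about a field `E` — `−23` is a
square, `X³ − X − 1` has no root, `−3` is not a square — into the group-theoretic binders of the
twisted-divisibility record shape (a normal subgroup `Stab(α) ⊴ Γ_E` of index `3`, an element
outside it, and "no primitive cube root of unity is fixed by `Stab(α)`"). This file proves the three
facts for `E = ℚ_v`, `v` the place of `ℚ` above `3` (`primesEquiv v = 3`), by transport along
Mathlib's `adicCompletion.padicEquiv v : ℚ_v ≃A[ℚ] ℚ_[3]` from:

* `isSquare_neg_twentyThree_padicThree` and `not_isSquare_neg_three_padicThree` — the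
  square-class decider of n1011-p17 (`LocalTorsion3.isSquare_intCast_padic_three_iff`:
  `−23 ≡ 1 (mod 3)` is a unit square; `−3` has odd valuation);
* `cubic_ne_zero_padicThree` — `X³ − X − 1` has no root in `ℚ_[3]`: a root has norm `≤ 1`
  (ultrametric inequality) and would reduce to a root in `ℤ/3` (`PadicInt.toZMod`), but
  `t³ − t − 1 ≠ 0` for `t = 0, 1, 2`.

and assembles `exists_cubicRootStabilizer_three`: for such `v` there is `α ∈ K̄_{ℚ_v}` with
`α³ = α + 1` whose stabiliser `H = Stab(α)` is normal of index `3` in `Γ_{ℚ_v}`, is not everything,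
and fixes no primitive cube root of unity — `H = Γ_M` for `M = ℚ₃(α)` the unramified cubic
extension. These are ALL the non-certificate binders at `v₀ = 3` of
`TwistedWitness.exists_sha_ne_zero_of_congr_of_twistedDivisible_of_rootsOfUnity` (FILE 3); what a
record still supplies is `t₃ = 3` (`hcard`, T-LOC3L) and the two local cube-root certificates
(d1) `Q'`, (d2) `Q₁` fixed by `Stab(α)`.

References: Mathlib `NumberTheory.Padics.HeightOneSpectrum` (`adicCompletion.padicEquiv`),
`NumberTheory.Padics.RingHoms` (`PadicInt.toZMod`); n1011-p17 `GaloisImage/PadicThreeSquareClass`.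
-/

noncomputable section

open scoped Classical

namespace Summit.BirchSwinnertonDyer.Rank1Residual.GaloisImage.TwistedWitness

open Field IsDedekindDomain NumberField Rat.HeightOneSpectrum

/-! ## §1 The three facts over `ℚ_[3]` -/

section PadicThree

/-- `−23` is a square in `ℚ_[3]` (`−23 ≡ 1 (mod 3)`, a unit square; n1011-p17's decider).
[folklore] -/
theorem isSquare_neg_twentyThree_padicThree : IsSquare ((-23 : ℤ) : ℚ_[3]) := by
  refine (LocalTorsion3.isSquare_intCast_padic_three_iff (-23) 0 (by norm_num) (by norm_num)).mpr ?_
  decide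

/-- `−3` is not a square in `ℚ_[3]` (odd valuation). [folklore] -/
theorem not_isSquare_neg_three_padicThree : ¬ IsSquare ((-3 : ℤ) : ℚ_[3]) := by
  rw [LocalTorsion3.isSquare_intCast_padic_three_iff (-3) 1 (by norm_num) (by norm_num)]
  decide

/-- **`X³ − X − 1` has no root in `ℚ_[3]`**: a root `x` has `‖x‖ ≤ 1` (if `‖x‖ > 1` then
`‖x³‖ = ‖x‖³ > ‖x‖ ≥ ‖x + 1‖`), so lies in `ℤ_[3]` and reduces to a root of `t³ − t − 1` in `ℤ/3`,
of which there is none (`t = 0, 1, 2 ↦ −1, −1, 5`). This is the residue-field irreducibility that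
makes `ℚ₃(α)` the unramified cubic extension. [folklore] -/
theorem cubic_ne_zero_padicThree (x : ℚ_[3]) : x ^ 3 - x - 1 ≠ 0 := by
  intro hx
  have hx' : x ^ 3 = x + 1 := by linear_combination hx
  -- `‖x‖ ≤ 1`
  have hnorm : ‖x‖ ≤ 1 := by
    by_contra hgt
    push Not at hgt
    have h1 : ‖x ^ 3‖ ≤ ‖x‖ := by
      rw [hx']
      refine (Padic.nonarchimedean x 1).trans ?_
      rw [norm_one]
      exact max_le le_rfl hgt.le
    rw [norm_pow] at h1
    have hpos : 0 < ‖x‖ := lt_trans zero_lt_one hgt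
    have hsq : 1 < ‖x‖ ^ 2 := one_lt_pow₀ hgt (by norm_num)
    nlinarith [mul_pos hpos (sub_pos.mpr hsq)]
  -- reduce modulo `3`
  set z : ℤ_[3] := ⟨x, hnorm⟩ with hz
  have hz3 : z ^ 3 - z - 1 = 0 := by
    apply Subtype.ext
    push_cast
    rw [hz]
    exact hx
  have ht := congrArg (PadicInt.toZMod (p := 3)) hz3
  rw [map_sub, map_sub, map_pow, map_one, map_zero] at ht
  generalize PadicInt.toZMod (p := 3) z = t at ht
  revert ht
  decide +revert

end PadicThree

/-! ## §2 Transport to `ℚ_v`, `v` the place of `3` -/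

section AdicCompletion

variable {v : HeightOneSpectrum (𝓞 ℚ)}

/-- Transport of "`n` is a square" from `ℚ_[p]` to `ℚ_v` along `adicCompletion.padicEquiv`.
[folklore] -/
theorem exists_sq_eq_intCast_adicCompletion_of_padic {p : ℕ} [Fact p.Prime]
    (hv : (primesEquiv v : ℕ) = p) {n : ℤ} (h : IsSquare ((n : ℤ) : ℚ_[p])) :
    ∃ δ : v.adicCompletion ℚ, δ ^ 2 = n := by
  subst hv
  obtain ⟨r, hr⟩ := h
  refine ⟨(adicCompletion.padicEquiv v).symm r, ?_⟩
  rw [sq, ← map_mul, ← hr, map_intCast]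

/-- Transport of "`n` is not a square" from `ℚ_[p]` to `ℚ_v`. [folklore] -/
theorem sq_ne_intCast_adicCompletion_of_padic {p : ℕ} [Fact p.Prime]
    (hv : (primesEquiv v : ℕ) = p) {n : ℤ} (h : ¬ IsSquare ((n : ℤ) : ℚ_[p]))
    (y : v.adicCompletion ℚ) : y ^ 2 ≠ n := by
  subst hv
  intro hy
  apply h
  refine ⟨adicCompletion.padicEquiv v y, ?_⟩
  rw [← sq, ← map_pow, hy, map_intCast]

/-- Transport of "`X³ − X − 1` has no root" from `ℚ_[p]` to `ℚ_v`. [folklore] -/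
theorem cubic_ne_zero_adicCompletion_of_padic {p : ℕ} [Fact p.Prime]
    (hv : (primesEquiv v : ℕ) = p) (h : ∀ x : ℚ_[p], x ^ 3 - x - 1 ≠ 0)
    (y : v.adicCompletion ℚ) : y ^ 3 - y - 1 ≠ 0 := by
  subst hv
  intro hy
  apply h (adicCompletion.padicEquiv v y)
  rw [← map_pow, ← map_sub, ← map_one (adicCompletion.padicEquiv v), ← map_sub, hy, map_zero]

/-- **At the place of `3`**: `∃ δ ∈ ℚ_v, δ² = −23`; `∀ y ∈ ℚ_v, y² ≠ −3`;
`∀ y ∈ ℚ_v, y³ − y − 1 ≠ 0`. [folklore] -/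
theorem three_facts_adicCompletion_three (hv : (primesEquiv v : ℕ) = 3) :
    (∃ δ : v.adicCompletion ℚ, δ ^ 2 = -23) ∧ (∀ y : v.adicCompletion ℚ, y ^ 2 ≠ -3) ∧
      ∀ y : v.adicCompletion ℚ, y ^ 3 - y - 1 ≠ 0 := by
  refine ⟨?_, fun y ↦ ?_, cubic_ne_zero_adicCompletion_of_padic hv cubic_ne_zero_padicThree⟩
  · obtain ⟨δ, hδ⟩ := exists_sq_eq_intCast_adicCompletion_of_padic hv
      (n := -23) (by exact_mod_cast isSquare_neg_twentyThree_padicThree)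
    exact ⟨δ, by rw [hδ]; push_cast; ring⟩
  · have h := sq_ne_intCast_adicCompletion_of_padic hv (n := -3)
      (by exact_mod_cast not_isSquare_neg_three_padicThree) y
    intro hy; apply h; rw [hy]; push_cast; ring

end AdicCompletion

/-! ## §3 The unramified-cubic subgroup of `Γ_{ℚ₃}` -/

section Assembly

/-- **The unramified-cubic subgroup at the place of `3`.** For `v` the place of `ℚ` above `3`
there is `α ∈ K̄_{ℚ_v}` with `α³ = α + 1` such that `H = Stab_{Γ_{ℚ_v}}(α)` is a normal subgroup of
index `3`, some element of `Γ_{ℚ_v}` lies outside `H`, and `H` fixes no primitive cube root of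
unity of `K̄_{ℚ_v}` (`H = Γ_{ℚ₃(α)}`, `ℚ₃(α)/ℚ₃` the unramified cubic extension; `ζ₃ ∉ ℚ₃(α)`). These
are the group-theoretic binders at `v₀ = 3` of the record shape
`exists_sha_ne_zero_of_congr_of_twistedDivisible_of_rootsOfUnity`. [folklore] -/
theorem exists_cubicRootStabilizer_three {v : HeightOneSpectrum (𝓞 ℚ)}
    (hv : (primesEquiv v : ℕ) = 3) :
    ∃ α : AlgebraicClosure (v.adicCompletion ℚ), α ^ 3 = α + 1 ∧
      (MulAction.stabilizer (absoluteGaloisGroup (v.adicCompletion ℚ)) α).Normal ∧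
      (MulAction.stabilizer (absoluteGaloisGroup (v.adicCompletion ℚ)) α).index = 3 ∧
      (∃ F : absoluteGaloisGroup (v.adicCompletion ℚ),
        F ∉ MulAction.stabilizer (absoluteGaloisGroup (v.adicCompletion ℚ)) α) ∧
      ∀ ζ : AlgebraicClosure (v.adicCompletion ℚ), ζ ^ 3 = 1 → ζ ≠ 1 →
        ∃ h ∈ MulAction.stabilizer (absoluteGaloisGroup (v.adicCompletion ℚ)) α, h • ζ ≠ ζ := by
  haveI : CharZero (v.adicCompletion ℚ) :=
    charZero_of_injective_algebraMap (algebraMap ℚ (v.adicCompletion ℚ)).injective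
  obtain ⟨⟨δ, hδ⟩, h3, hnoroot⟩ := three_facts_adicCompletion_three hv
  obtain ⟨α, hα⟩ := exists_cubicRoot (v.adicCompletion ℚ)
  exact ⟨α, hα, normal_stabilizer_cubicRoot hα hδ, index_stabilizer_cubicRoot hα hδ hnoroot,
    exists_smul_cubicRoot_ne hα hδ hnoroot,
    exists_mem_stabilizer_smul_ne_of_cube_eq_one hα hδ hnoroot h3⟩

end Assembly

end Summit.BirchSwinnertonDyer.Rank1Residual.GaloisImage.TwistedWitness

end
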